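import Mathlib
import Literature.Computability.AlgebraicComplexity.LRPencilOfMatrix
import Summits.ValiantsHypothesis.ValiantsHypothesis.Theorems.GrenetZeonTwoDimCoefficientsPermanentFlatOrder

/-!
# The TRIANGULARISABLE rung for `stub_dualUnipotent`: `n² ≤ 2kn + m·q` (so `m ≳ n^{3/2}/(2√2)`)

Crux `GrenetZeon.TwoDimCoefficients` (stmt-ValiantsHypothesis-8062), line `dim2_cases`, stub
`stub_dualUnipotent` (`DualUnipotentBound`, OPEN-PROBLEM GRADE).  Every unipotent dual representation
has the normal form `per_n = tr(N^{n−1}·M)` with `N, M` LINEAR `m × m` pencils, `N` nilpotent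
(`exists_nilpotent_pencil_of_dualUnipotentRepr`, 8062-p1 g2).  This file settles the sub-case where
the nilpotent pencil `N` is SIMULTANEOUSLY TRIANGULARISABLE (every layered / DAG construction —
ABP gadgets, trace-IMM, Grenet — and the profile-barrier chain; conjugate first,
`tr((P⁻¹NP)^d(P⁻¹MP)) = tr(N^dM)`): `Cruxes/TwoDimCoefficients/TRIANGULARISABLE-RUNG.md`.

**Theorem (`sq_le_of_trace_pow_mul_strictUpper`).** If `per_n = tr(N^d·M)` with `N, M` affine
`m × m` pencils over `ℂ[x_ij]` and `N` strictly upper triangular, then for all `q ≥ 1` and `k` with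
`m ≤ k·q`:  `n² ≤ 2kn + m·q`.  Corollary (`…strictUpper'`): `q·n² ≤ 2n(m+q) + m·q²` for every `q ≥ 1`,
i.e. (with `q ≈ √(2n)`) `m ≳ n^{3/2}/(2√2)` — versus `m ≥ √2·n` for general pencils
(`two_mul_sq_le_of_dualUnipotentRepr`) and the stub's `n²/C`.

Proof.  Blocks of size `q` (`≤ k` of them); `K ≤ ℂ^{n²}` = directions killing the WITHIN-BLOCK linear
coefficients of `N` (`codim K ≤ m·q`).  Along `x + Σ_t s_t v_t` (`v_t ∈ K`) the pencil
`N(x) + Σ_t s_t N(v_t)` is BLOCK-GRADED (entry `(i,j)` has `s`-degree `≤ block j − block i`: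
`blockGraded_aeval_line`, `blockGraded_mul/pow`), so `tr(N^d M)` pulls back with `s`-degree `≤ k`
(`totalDegree_aeval_line_trace_le`); hence all `(k+1)`-st derivatives of `per_n` along `K` vanish
(`foldr_mkDerivation_eq_zero_of_totalDegree_le`, chain rule `aeval_line_mkDerivation`) and LEMMA_k
(`finrank_le_of_iterD_perPoly_eq_zero`) gives `dim K ≤ 2kn`.

HONEST FRAMING: a sub-case rung (`n^{3/2}` in the triangularisable = layered world; the rate of
8062-p2 g2's profile barrier, by a non-pointwise method); the located open point of the stub is the
WILD (non-triangularisable) nilpotent pencils; the stub, the crux (an ASIDE item) and `VP ≠ VNP` are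
not moved.
-/

set_option linter.dupNamespace false

noncomputable section

namespace Summit.ValiantsHypothesis.ValiantsHypothesis.Cruxes.TwoDimCoefficients.DimTwoCases

open MvPolynomial Matrix
open Literature.Computability.AlgebraicComplexity

/-! ### Pull-back to the parameter space of a coset: iterated derivatives vs. degree -/

section Pullback

variable {σ : Type*} {k : ℕ}

/-- Chain rule: pulling back along `x + Σ_t s_t v_t` turns the directional derivative `D_{v_t}`
into `∂/∂s_t`. [folklore] -/
theorem aeval_line_mkDerivation (x : σ → ℂ) (v : Fin k → (σ → ℂ)) (t : Fin k)
    (f : MvPolynomial σ ℂ) :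
    aeval (fun c => C (x c) + ∑ t, C (v t c) * X t)
        (mkDerivation ℂ (fun c => (C (v t c) : MvPolynomial σ ℂ)) f) =
      pderiv t (aeval (fun c => (C (x c) + ∑ t, C (v t c) * X t : MvPolynomial (Fin k) ℂ)) f) := by
  induction f using MvPolynomial.induction_on with
  | C a =>
      rw [mkDerivation_const_eq_zero, map_zero, aeval_C, MvPolynomial.algebraMap_eq, pderiv_C]
  | add p q hp hq => simp only [map_add, hp, hq]
  | mul_X p c hp =>
      rw [Derivation.leibniz, mkDerivation_X, smul_eq_mul, smul_eq_mul, map_add, map_mul, map_mul,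
        hp, aeval_C, aeval_X, map_mul, pderiv_mul, aeval_X, MvPolynomial.algebraMap_eq]
      have hlin : pderiv t (C (x c) + ∑ t', C (v t' c) * (X t' : MvPolynomial (Fin k) ℂ)) = C (v t c) := by
        rw [map_add, pderiv_C, zero_add, map_sum]
        simp only [pderiv_C_mul, pderiv_X]
        rw [Finset.sum_eq_single t]
        · simp
        · intro t' _ ht'
          rw [Pi.single_eq_of_ne ht', mul_zero]
        · simp
      rw [hlin]
      ring

/-- Iterated chain rule for the pull-back along `x + Σ_t s_t v_t`. [folklore] -/
theorem aeval_line_foldr_mkDerivation (x : σ → ℂ) (v : Fin k → (σ → ℂ)) (ts : List (Fin k))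
    (f : MvPolynomial σ ℂ) :
    aeval (fun c => C (x c) + ∑ t, C (v t c) * X t)
        (ts.foldr (fun t g => mkDerivation ℂ (fun c => (C (v t c) : MvPolynomial σ ℂ)) g) f) =
      ts.foldr (fun t g => pderiv t g)
        (aeval (fun c => (C (x c) + ∑ t, C (v t c) * X t : MvPolynomial (Fin k) ℂ)) f) := by
  induction ts with
  | nil => simp
  | cons t ts ih => rw [List.foldr_cons, List.foldr_cons, aeval_line_mkDerivation, ih]

/-- The pull-back at `s = 0` is the value at `x`. [folklore] -/
theorem constantCoeff_aeval_line (x : σ → ℂ) (v : Fin k → (σ → ℂ)) (f : MvPolynomial σ ℂ) :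
    constantCoeff (aeval (fun c => (C (x c) + ∑ t, C (v t c) * X t : MvPolynomial (Fin k) ℂ)) f) =
      eval x f := by
  induction f using MvPolynomial.induction_on with
  | C a => simp
  | add p q hp hq => simp only [map_add, hp, hq]
  | mul_X p c hp =>
      simp only [map_mul, hp, aeval_X, map_add, constantCoeff_C, map_sum, constantCoeff_X,
        mul_zero, Finset.sum_const_zero, add_zero, eval_X]

/-- `∂_i` lowers the total degree by one. [folklore] -/
theorem totalDegree_pderiv_le {ι : Type*} (i : ι) (f : MvPolynomial ι ℂ) :
    (pderiv i f).totalDegree ≤ f.totalDegree - 1 := by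
  classical
  rw [MvPolynomial.totalDegree]
  refine Finset.sup_le fun mo hmo => ?_
  have hc : coeff (mo + Finsupp.single i 1) f ≠ 0 := by
    intro h0
    rw [MvPolynomial.mem_support_iff, coeff_pderiv, h0, zero_mul] at hmo
    exact hmo rfl
  have hle := le_totalDegree (MvPolynomial.mem_support_iff.mpr hc)
  rw [Finsupp.sum_add_index' (fun _ => rfl) (fun _ _ _ => rfl), Finsupp.sum_single_index rfl] at hle
  omega

/-- Iterated partial derivatives lower the total degree by their number. [folklore] -/
theorem totalDegree_foldr_pderiv_le {ι : Type*} (ts : List ι) (g : MvPolynomial ι ℂ) :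
    (ts.foldr (fun t h => pderiv t h) g).totalDegree ≤ g.totalDegree - ts.length := by
  induction ts with
  | nil => simp
  | cons t ts ih =>
      have h := totalDegree_pderiv_le t (ts.foldr (fun t h => pderiv t h) g)
      rw [List.foldr_cons, List.length_cons]; omega

/-- `j` partial derivatives kill a polynomial of total degree `< j`. [folklore] -/
theorem foldr_pderiv_eq_zero_of_totalDegree_lt {ι : Type*} (ts : List ι) (g : MvPolynomial ι ℂ)
    (hg : g.totalDegree < ts.length) : ts.foldr (fun t h => pderiv t h) g = 0 := by
  induction ts with
  | nil => simp at hg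
  | cons t ts ih =>
      rw [List.foldr_cons]; rw [List.length_cons] at hg
      by_cases hlt : g.totalDegree < ts.length
      · rw [ih hlt, map_zero]
      · have h0 : (ts.foldr (fun t h => pderiv t h) g).totalDegree = 0 := by
          have h := totalDegree_foldr_pderiv_le ts g; omega
        rw [totalDegree_eq_zero_iff_eq_C] at h0
        rw [h0, pderiv_C]

/-- **Flatness from degree on cosets.** If for every base point `x` and every choice of `k + 1`
directions `v_t` from `K` the pull-back `s ↦ f(x + Σ_t s_t v_t)` has total degree `≤ k`, then all
`(k+1)`-st order directional derivatives of `f` along `K` vanish identically. [folklore] -/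
theorem foldr_mkDerivation_eq_zero_of_totalDegree_le [Fintype σ] (K : Submodule ℂ (σ → ℂ)) (f : MvPolynomial σ ℂ)
    (hdeg : ∀ (x : σ → ℂ) (v : Fin (k + 1) → (σ → ℂ)), (∀ t, v t ∈ K) →
      (aeval (fun c => (C (x c) + ∑ t, C (v t c) * X t : MvPolynomial (Fin (k + 1)) ℂ)) f).totalDegree ≤ k)
    (d : Fin (k + 1) → (σ → ℂ)) (hd : ∀ t, d t ∈ K) :
    (List.ofFn d).foldr (fun u g => mkDerivation ℂ (fun c => (C (u c) : MvPolynomial σ ℂ)) g) f = 0 := by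
  classical
  apply MvPolynomial.funext
  intro x
  rw [map_zero, ← constantCoeff_aeval_line x d]
  have hfold : (List.ofFn d).foldr (fun u g => mkDerivation ℂ (fun c => (C (u c) : MvPolynomial σ ℂ)) g) f =
      (List.finRange (k + 1)).foldr
        (fun t g => mkDerivation ℂ (fun c => (C (d t c) : MvPolynomial σ ℂ)) g) f := by
    rw [List.ofFn_eq_map, List.foldr_map]
  rw [hfold, aeval_line_foldr_mkDerivation, foldr_pderiv_eq_zero_of_totalDegree_lt, map_zero]
  rw [List.length_finRange]
  exact Nat.lt_succ_of_le (hdeg x d hd)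

/-- The pull-back of an affine polynomial along `x + Σ_t s_t v_t` is
`g(x) + Σ_t (Σ_c v_t(c)·coeff_{x_c} g)·s_t`. [folklore] -/
theorem aeval_line_of_totalDegree_le_one [Fintype σ] (x : σ → ℂ) (v : Fin k → (σ → ℂ))
    {g : MvPolynomial σ ℂ} (hg : g.totalDegree ≤ 1) :
    aeval (fun c => (C (x c) + ∑ t, C (v t c) * X t : MvPolynomial (Fin k) ℂ)) g =
      C (eval x g) + ∑ t, C (∑ c, v t c * coeff (Finsupp.single c 1) g) * X t := by
  have hg' := LRPencil.eq_affine_of_totalDegree_le_one g hg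
  have heval : eval x g = coeff 0 g + ∑ w, coeff (Finsupp.single w 1) g * x w := by
    conv_lhs => rw [hg']; simp [eval_X]
  rw [heval]
  conv_lhs => rw [hg']
  simp only [map_add, map_sum, map_mul, aeval_C, aeval_X, MvPolynomial.algebraMap_eq, mul_add,
    Finset.mul_sum, Finset.sum_add_distrib]
  rw [← add_assoc]; congr 1; rw [Finset.sum_comm]
  refine Finset.sum_congr rfl fun t _ => ?_
  rw [Finset.sum_mul]; exact Finset.sum_congr rfl fun c _ => by ring

end Pullback

/-! ### Block-graded matrices and the triangular model -/

section Triangular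

variable {m q k : ℕ}

/-- Products of block-graded matrices (degree + block(row) ≤ block(col) on non-zero entries) are
block-graded. [folklore] -/
theorem blockGraded_mul (Y Z : Matrix (Fin m) (Fin m) (MvPolynomial (Fin (k + 1)) ℂ))
    (hY : ∀ i j, Y i j ≠ 0 → (Y i j).totalDegree + i.val / q ≤ j.val / q)
    (hZ : ∀ i j, Z i j ≠ 0 → (Z i j).totalDegree + i.val / q ≤ j.val / q) :
    ∀ i j, (Y * Z) i j ≠ 0 → ((Y * Z) i j).totalDegree + i.val / q ≤ j.val / q := by
  intro i j hij
  rw [Matrix.mul_apply] at hij ⊢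
  obtain ⟨l, -, hl⟩ := Finset.exists_ne_zero_of_sum_ne_zero hij
  have hYl : Y i l ≠ 0 := fun h => hl (by rw [h, zero_mul])
  have hZl : Z l j ≠ 0 := fun h => hl (by rw [h, mul_zero])
  have hblock : i.val / q ≤ j.val / q :=
    ((Nat.le_add_left _ _).trans (hY i l hYl)).trans ((Nat.le_add_left _ _).trans (hZ l j hZl))
  have hterm : ∀ l', (Y i l' * Z l' j).totalDegree + i.val / q ≤ j.val / q := by
    intro l'
    by_cases h0 : Y i l' * Z l' j = 0
    · rw [h0, totalDegree_zero, zero_add]; exact hblock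
    · have h1 := hY i l' (fun h => h0 (by rw [h, zero_mul]))
      have h2 := hZ l' j (fun h => h0 (by rw [h, mul_zero]))
      have h3 := totalDegree_mul (Y i l') (Z l' j)
      omega
  have hsum := totalDegree_finsetSum Finset.univ (fun l' => Y i l' * Z l' j)
  have hsup : (Finset.univ.sup fun l' => (Y i l' * Z l' j).totalDegree) + i.val / q ≤ j.val / q := by
    have : Finset.univ.sup (fun l' => (Y i l' * Z l' j).totalDegree) ≤ j.val / q - i.val / q :=
      Finset.sup_le fun l' _ => by have := hterm l'; omega
    omega
  omega

/-- Powers of a block-graded matrix are block-graded. [folklore] -/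
theorem blockGraded_pow (Y : Matrix (Fin m) (Fin m) (MvPolynomial (Fin (k + 1)) ℂ))
    (hY : ∀ i j, Y i j ≠ 0 → (Y i j).totalDegree + i.val / q ≤ j.val / q) (d : ℕ) :
    ∀ i j, (Y ^ d) i j ≠ 0 → ((Y ^ d) i j).totalDegree + i.val / q ≤ j.val / q := by
  induction d with
  | zero =>
      intro i j hij
      rw [pow_zero] at hij ⊢
      by_cases h : i = j
      · subst h; rw [Matrix.one_apply_eq, totalDegree_one, zero_add]
      · exact absurd (Matrix.one_apply_ne h) hij
  | succ d ih =>
      rw [pow_succ]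
      exact blockGraded_mul _ _ ih hY

/-- The pull-back of an affine polynomial along a line arrangement has total degree `≤ 1`. [folklore] -/
theorem totalDegree_aeval_line_le_one {σ : Type*} [Fintype σ] (x : σ → ℂ) (v : Fin (k + 1) → (σ → ℂ))
    {g : MvPolynomial σ ℂ} (hg : g.totalDegree ≤ 1) :
    (aeval (fun c => (C (x c) + ∑ t, C (v t c) * X t : MvPolynomial (Fin (k + 1)) ℂ)) g).totalDegree ≤ 1 := by
  rw [aeval_line_of_totalDegree_le_one x v hg]
  refine (totalDegree_add _ _).trans (max_le ?_ ?_)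
  · rw [totalDegree_C]; exact Nat.zero_le _
  · refine (totalDegree_finsetSum _ _).trans (Finset.sup_le fun t _ => ?_)
    refine (totalDegree_mul _ _).trans ?_
    rw [totalDegree_C, zero_add, totalDegree_X]

/-- **Block grading of the pulled-back pencil.** If `N` is an affine, strictly upper triangular
matrix pencil and the directions `v_t` kill the within-block linear coefficients of `N` (block size
`q`), then the pull-back of `N` along `x + Σ_t s_t v_t` is block-graded: an entry `(i, j)` has
`s`-degree `≤ block(j) − block(i)`. [folklore] -/
theorem blockGraded_aeval_line {n : ℕ} (N : Matrix (Fin m) (Fin m) (MvPolynomial (Fin n × Fin n) ℂ))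
    (hN : ∀ i j, (N i j).totalDegree ≤ 1) (htri : ∀ i j : Fin m, j ≤ i → N i j = 0)
    (x : Fin n × Fin n → ℂ) (v : Fin (k + 1) → (Fin n × Fin n → ℂ))
    (hv : ∀ t (i j : Fin m), i.val / q = j.val / q →
      ∑ c, v t c * coeff (Finsupp.single c 1) (N i j) = 0) :
    ∀ i j, (N.map (aeval (fun c => (C (x c) + ∑ t, C (v t c) * X t : MvPolynomial (Fin (k + 1)) ℂ))))
        i j ≠ 0 →
      ((N.map (aeval (fun c => (C (x c) + ∑ t, C (v t c) * X t : MvPolynomial (Fin (k + 1)) ℂ))))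
        i j).totalDegree + i.val / q ≤ j.val / q := by
  intro i j hij
  rw [Matrix.map_apply] at hij ⊢
  have hlt : i < j := by
    by_contra h
    push Not at h
    exact hij (by rw [htri i j h, map_zero])
  have hblock : i.val / q ≤ j.val / q := Nat.div_le_div_right (le_of_lt hlt)
  by_cases heq : i.val / q = j.val / q
  · rw [aeval_line_of_totalDegree_le_one x v (hN i j)]
    simp only [hv _ i j heq, map_zero, zero_mul, Finset.sum_const_zero, add_zero, totalDegree_C,
      zero_add]
    exact hblock
  · have h1 := totalDegree_aeval_line_le_one x v (hN i j)
    omega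

/-- **Degree of the pulled-back trace product.** With `N` as in `blockGraded_aeval_line`, `M`
affine, block size `q ≥ 1` and `m ≤ k·q` (at most `k` blocks), the pull-back of `tr(N^d · M)`
along `x + Σ_t s_t v_t` has total `s`-degree `≤ k`. [folklore] -/
theorem totalDegree_aeval_line_trace_le {n d : ℕ}
    (N M : Matrix (Fin m) (Fin m) (MvPolynomial (Fin n × Fin n) ℂ))
    (hN : ∀ i j, (N i j).totalDegree ≤ 1) (hM : ∀ i j, (M i j).totalDegree ≤ 1)
    (htri : ∀ i j : Fin m, j ≤ i → N i j = 0) (hq : 1 ≤ q) (hmk : m ≤ k * q)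
    (x : Fin n × Fin n → ℂ) (v : Fin (k + 1) → (Fin n × Fin n → ℂ))
    (hv : ∀ t (i j : Fin m), i.val / q = j.val / q →
      ∑ c, v t c * coeff (Finsupp.single c 1) (N i j) = 0) :
    (aeval (fun c => (C (x c) + ∑ t, C (v t c) * X t : MvPolynomial (Fin (k + 1)) ℂ))
      ((N ^ d * M).trace)).totalDegree ≤ k := by
  set θ : Fin n × Fin n → MvPolynomial (Fin (k + 1)) ℂ := fun c => C (x c) + ∑ t, C (v t c) * X t
    with hθ
  have hmap : aeval θ ((N ^ d * M).trace) = ((N.map (aeval θ)) ^ d * M.map (aeval θ)).trace := by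
    rw [show N.map (aeval θ) = (aeval θ).toRingHom.mapMatrix N from rfl,
      show M.map (aeval θ) = (aeval θ).toRingHom.mapMatrix M from rfl, ← map_pow, ← map_mul]
    simp only [Matrix.trace, Matrix.diag_apply, map_sum, RingHom.mapMatrix_apply, Matrix.map_apply]
    rfl
  rw [hmap, Matrix.trace]
  simp only [Matrix.diag_apply, Matrix.mul_apply]
  have hgr := blockGraded_pow (q := q) (N.map (aeval θ)) (blockGraded_aeval_line N hN htri x v hv) d
  have hbound : ∀ i j : Fin m, ((N.map (aeval θ) ^ d) i j * (M.map (aeval θ)) j i).totalDegree ≤ k := by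
    intro i j
    by_cases h0 : (N.map (aeval θ) ^ d) i j = 0
    · rw [h0, zero_mul, totalDegree_zero]; exact Nat.zero_le _
    · have h1 := hgr i j h0
      have h2 : ((M.map (aeval θ)) j i).totalDegree ≤ 1 := by
        rw [Matrix.map_apply]; exact totalDegree_aeval_line_le_one x v (hM j i)
      have h3 := totalDegree_mul ((N.map (aeval θ) ^ d) i j) ((M.map (aeval θ)) j i)
      have hj : j.val / q + 1 ≤ k := by
        have hjm : j.val < k * q := lt_of_lt_of_le j.isLt hmk
        have : j.val / q < k := by
          rw [Nat.div_lt_iff_lt_mul (by omega)]; exact hjm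
        omega
      have hf : ((N.map (aeval θ) ^ d) i j).totalDegree ≤ j.val / q := le_trans (Nat.le_add_right _ _) h1
      generalize j.val / q = e at hj hf
      omega
  refine (totalDegree_finsetSum _ _).trans (Finset.sup_le fun i _ => ?_)
  exact (totalDegree_finsetSum _ _).trans (Finset.sup_le fun j _ => hbound i j)

/-- **TRIANGULARISABLE RUNG (homogeneous normal form).** If `per_n = tr(N^d · M)` with `N, M`
affine `m × m` matrix pencils and `N` STRICTLY UPPER TRIANGULAR (as polynomials), then for every
block size `q ≥ 1` and every `k` with `m ≤ k·q`:  `n² ≤ 2kn + m·q`.  (Optimising, `q ≈ √(2n)`,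
`k ≈ m/q`: `m ≳ n^{3/2}/(2√2)`.)  Proof: the subspace `K` of directions killing the within-block
linear coefficients of `N` has codimension `≤ m·q`; along `K` the pull-back of `tr(N^d M)` to any
coset has degree `≤ k` (block grading: `totalDegree_aeval_line_trace_le`), so all `(k+1)`-st
derivatives of `per_n` along `K` vanish (`foldr_mkDerivation_eq_zero_of_totalDegree_le`) and
LEMMA_k (`finrank_le_of_iterD_perPoly_eq_zero`) gives `dim K ≤ 2kn`. Every unipotent dual
representation has the normal form `per_n = tr(N^{n−1} M)` (`exists_nilpotent_pencil_of_dualUnipotentRepr`,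
8062-p1 g2); this theorem is the case where the nilpotent pencil `N` is simultaneously
triangularisable (conjugate first: `tr((P⁻¹NP)^d (P⁻¹MP)) = tr(N^d M)`). [folklore] -/
theorem sq_le_of_trace_pow_mul_strictUpper {n d : ℕ}
    (N M : Matrix (Fin m) (Fin m) (MvPolynomial (Fin n × Fin n) ℂ))
    (hN : ∀ i j, (N i j).totalDegree ≤ 1) (hM : ∀ i j, (M i j).totalDegree ≤ 1)
    (htri : ∀ i j : Fin m, j ≤ i → N i j = 0)
    (hper : perPoly (Fin n) ℂ = (N ^ d * M).trace) (hq : 1 ≤ q) (hmk : m ≤ k * q) :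
    n ^ 2 ≤ k * (2 * n) + m * q := by
  classical
  -- the within-block linear coefficients of `N`
  let F : (Fin n × Fin n → ℂ) →ₗ[ℂ] (Fin m → Fin q → ℂ) :=
    { toFun := fun v i r => if h : (i.val / q) * q + r.val < m then
          ∑ c, v c * coeff (Finsupp.single c 1) (N i ⟨(i.val / q) * q + r.val, h⟩) else 0
      map_add' := fun v w => by
        funext i r
        simp only [Pi.add_apply]
        split_ifs
        · simp only [add_mul, Finset.sum_add_distrib]
        · simp
      map_smul' := fun a v => by
        funext i r
        simp only [Pi.smul_apply, smul_eq_mul, RingHom.id_apply]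
        split_ifs
        · rw [Finset.mul_sum]
          exact Finset.sum_congr rfl fun c _ => by ring
        · simp }
  have hF : ∀ v i r, F v i r = if h : (i.val / q) * q + r.val < m then
      ∑ c, v c * coeff (Finsupp.single c 1) (N i ⟨(i.val / q) * q + r.val, h⟩) else 0 := fun v i r => rfl
  set K := LinearMap.ker F with hKdef
  have hvK : ∀ v ∈ K, ∀ i j : Fin m, i.val / q = j.val / q →
      ∑ c, v c * coeff (Finsupp.single c 1) (N i j) = 0 := by
    intro v hv i j hij
    rw [hKdef, LinearMap.mem_ker] at hv
    have hr : j.val % q < q := Nat.mod_lt _ (by omega)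
    have h := congrFun (congrFun hv i) ⟨j.val % q, hr⟩
    rw [hF, Pi.zero_apply, Pi.zero_apply] at h
    have hjm : (i.val / q) * q + j.val % q < m := by
      rw [hij, Nat.div_add_mod']; exact j.isLt
    rw [dif_pos hjm] at h
    have hfin : (⟨(i.val / q) * q + j.val % q, hjm⟩ : Fin m) = j :=
      Fin.ext (by simp only [hij, Nat.div_add_mod'])
    rwa [hfin] at h
  -- flatness of `per_n` along `K` to order `k + 1`
  have hflat : ∀ dv : Fin (k + 1) → (Fin n × Fin n → ℂ), (∀ t, dv t ∈ K) →
      (List.ofFn dv).foldr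
        (fun u g => mkDerivation ℂ (fun c => (C (u c) : MvPolynomial (Fin n × Fin n) ℂ)) g)
        (perPoly (Fin n) ℂ) = 0 := by
    intro dv hdv
    refine foldr_mkDerivation_eq_zero_of_totalDegree_le K _ (fun x v hv => ?_) dv hdv
    rw [hper]
    exact totalDegree_aeval_line_trace_le N M hN hM htri hq hmk x v
      (fun t i j hij => hvK (v t) (hv t) i j hij)
  have hdimK : Module.finrank ℂ K ≤ k * (2 * n) := finrank_le_of_iterD_perPoly_eq_zero K hflat
  -- rank–nullity for `F`
  have hrn := LinearMap.finrank_range_add_finrank_ker F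
  have hrange : Module.finrank ℂ (LinearMap.range F) ≤ m * q := by
    calc Module.finrank ℂ (LinearMap.range F)
        ≤ Module.finrank ℂ (Fin m → Fin q → ℂ) := Submodule.finrank_le _
      _ = m * q := by
          rw [Module.finrank_pi_fintype]
          simp only [Module.finrank_fintype_fun_eq_card, Fintype.card_fin, Finset.sum_const,
            Finset.card_univ, smul_eq_mul]
  rw [Module.finrank_fintype_fun_eq_card, Fintype.card_prod, Fintype.card_fin, ← hKdef] at hrn
  nlinarith [hrn, hrange, hdimK]

/-- **Triangularisable rung, `k`-free form:** for every block size `q ≥ 1`,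
`q·n² ≤ 2n(m + q) + m·q²`; with `q ≈ √(2n)` this is `m ≥ (n − O(1))·√(2n)/4`, i.e. the unipotent
dual model restricted to TRIANGULARISABLE pencils needs width `≳ n^{3/2}/(2√2)` for the permanent
(the general stub asks for `n²/C`; the best general bound is `√2·n`, p589825). [folklore] -/
theorem sq_le_of_trace_pow_mul_strictUpper' {n d : ℕ}
    (N M : Matrix (Fin m) (Fin m) (MvPolynomial (Fin n × Fin n) ℂ))
    (hN : ∀ i j, (N i j).totalDegree ≤ 1) (hM : ∀ i j, (M i j).totalDegree ≤ 1)
    (htri : ∀ i j : Fin m, j ≤ i → N i j = 0)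
    (hper : perPoly (Fin n) ℂ = (N ^ d * M).trace) (hq : 1 ≤ q) :
    q * n ^ 2 ≤ 2 * n * (m + q) + m * q ^ 2 := by
  have hmk : m ≤ (m / q + 1) * q := by
    have h1 := Nat.div_add_mod m q
    have h2 := Nat.mod_lt m (by omega : 0 < q)
    nlinarith
  have h := sq_le_of_trace_pow_mul_strictUpper (k := m / q + 1) N M hN hM htri hper hq hmk
  have h3 : (m / q) * q ≤ m := Nat.div_mul_le_self m q
  nlinarith [h, h3]

end Triangular

end Summit.ValiantsHypothesis.ValiantsHypothesis.Cruxes.TwoDimCoefficients.DimTwoCases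

end
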